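import Summits.CriticalPhenomena.Ising3D.TaylorOddConeQPoly
import Summits.CriticalPhenomena.Ising3D.TaylorRegionKernel
import Mathlib.Tactic.Linarith
import Mathlib.Tactic.Positivity
import Mathlib.Tactic.Ring
import HarnessLib

/-!
# The odd CONE of a derivative certificate from a TWO-VARIABLE POLYNOMIAL kernel condition
(cell `pub-ising3x`, seat recog-1 gen 10; gate (g2), odd sector with (D5b): the tail cone without
Legendre-polynomial asymptotics — the odd twin of `taylorEvenRegion_half_of_kernelRegion`)

HONEST FRAMING: lottery ticket; floor = tightest certified 3D Ising CFT bounds; no exact-solution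
claim without a proof.

Every weighted q-sum at `(½,½)` is a `λ`-average of kernel values on the antidiagonal
(`qSum_eq_sum_evenKernel`: `qSum c S s σ E j = Σ_{p₁+p₂=j} λ_{p₁}λ_{p₂} K(u,v)`, `u = (E-j)/2 + p₁ ≥ 0`,
`v = (E-j)/2 + p₂ ≥ 0`, `u + v = E`). The odd cone inequalities (M̂), (R̂) of `oddConeAt_half_of_qCone` are
LINEAR in the q-sums apart from `|q̂₃|`, and `|Σ λλ K₃| ≤ Σ λλ |K₃|`; hence they FOLLOW from the pointwise
kernel conditions on the half-plane region `{u, v ≥ 0, u + v ≥ E_T}`: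
(KM) `(½)^{Δσ+Δε} |K₃(u,v)| ≤ K_{ψ,0}(u,v)`,
(KR) `½κ₀ (½)^{Δε-Δσ} |K₃(u,v)| + ½κ₀⁻¹ (½)^{-2Δε} K_{ψ,t}(u,v) ≤ K₄(u,v) - K₅(u,v)`,
with `K₃ = evenKernel (w 2) S s̄ (-1)`, `K₄ = evenKernel (w 3) S Δσ (-1)`, `K₅ = evenKernel (w 4) S Δσ 1`,
`K_{ψ,0} = evenKernel ψ Sψ 0 0`, `K_{ψ,t} = evenKernel ψ Sψ (Δσ-Δε) 0` (`s̄ = (Δσ+Δε)/2`) — four polynomial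
inequalities (`±K₃`) in two real variables per box of `(Δσ, Δε)`, decidable box by box plus a leading-form
argument, exactly like the even sector's kernel region (`oddCone_half_of_kernelCone`, `κ₀ ≥ 0`).
SUFFICIENT only. Elementary.
-/

namespace Summit.CriticalPhenomena.Ising3D

open Finset Set
open Literature.MathematicalPhysics.QuantumFieldTheory.ConformalBootstrap3D

/-- `|Σ_{p} λλ K| ≤ Σ_{p} λλ |K|` on an antidiagonal. [folklore] -/
theorem abs_sum_antidiagonal_lam_le (j : ℕ) (K : ℕ × ℕ → ℝ) :
    |∑ p ∈ antidiagonal j, legendreLam p.1 * legendreLam p.2 * K p| ≤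
      ∑ p ∈ antidiagonal j, legendreLam p.1 * legendreLam p.2 * |K p| := by
  refine (Finset.abs_sum_le_sum_abs _ _).trans (le_of_eq (Finset.sum_congr rfl fun p _ => ?_))
  rw [abs_mul, abs_of_nonneg (mul_nonneg (legendreLam_pos _).le (legendreLam_pos _).le)]

/-- **The kernel condition implies the odd cone** for `α = taylorCrossing ½ ½ S w` and the majorant
`Ψ = Σ ψ(a,b) · taylorCoeffAt ½ ½ (a,b)` (`κ₀ ≥ 0`): (KM) and (KR) on `{u, v ≥ 0, u + v ≥ E_T}` give
`OddConeAt` at every `(E, j)` with `E ≥ E_T`, `j ≤ E`. [cite: KosPolandSimmonsduffin2014, §3.3 eq. (3.16)] -/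
theorem oddCone_half_of_kernelCone (S : Finset (ℕ × ℕ)) (w : Fin 5 → ℕ × ℕ → ℝ)
    (Sψ : Finset (ℕ × ℕ)) (ψ : ℕ × ℕ → ℝ) {κ₀ : ℝ} (hκ₀ : 0 ≤ κ₀) (Δσ Δε E_T : ℝ)
    (hK : ∀ u v : ℝ, 0 ≤ u → 0 ≤ v → E_T ≤ u + v →
      (1 / 2 : ℝ) ^ (Δσ + Δε) * |evenKernel (w 2) S ((Δσ + Δε) / 2) (-1) u v| ≤
          evenKernel ψ Sψ 0 0 u v ∧
        κ₀ / 2 * ((1 / 2 : ℝ) ^ (Δε - Δσ) * |evenKernel (w 2) S ((Δσ + Δε) / 2) (-1) u v|) +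
            κ₀⁻¹ / 2 * ((1 / 2 : ℝ) ^ (-(2 * Δε)) * evenKernel ψ Sψ (Δσ - Δε) 0 u v) ≤
          evenKernel (w 3) S Δσ (-1) u v - evenKernel (w 4) S Δσ 1 u v) :
    ∀ (E : ℝ) (j : ℕ), E_T ≤ E → (j : ℝ) ≤ E →
      OddConeAt (taylorCrossing (1 / 2) (1 / 2) S w)
        (∑ ab ∈ Sψ, ψ ab • taylorCoeffAt (1 / 2) (1 / 2) ab) κ₀ Δσ Δε E j := by
  intro E j hE hj
  have h0 : (0 : ℝ) < 1 / 2 := by norm_num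
  have hκ₁ : 0 ≤ (1 / 2 : ℝ) ^ (Δσ + Δε) := (Real.rpow_pos_of_pos h0 _).le
  have hκ₂ : 0 ≤ (1 / 2 : ℝ) ^ (Δε - Δσ) := (Real.rpow_pos_of_pos h0 _).le
  have hlam0 : ∀ q : ℕ × ℕ, 0 ≤ legendreLam q.1 * legendreLam q.2 :=
    fun q => mul_nonneg (legendreLam_pos _).le (legendreLam_pos _).le
  -- the antidiagonal points lie in the region, so (KM)/(KR) hold there
  have hKq : ∀ q ∈ antidiagonal j,
      (1 / 2 : ℝ) ^ (Δσ + Δε) *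
            |evenKernel (w 2) S ((Δσ + Δε) / 2) (-1) ((E - (j : ℝ)) / 2 + q.1) ((E - (j : ℝ)) / 2 + q.2)| ≤
          evenKernel ψ Sψ 0 0 ((E - (j : ℝ)) / 2 + q.1) ((E - (j : ℝ)) / 2 + q.2) ∧
        κ₀ / 2 * ((1 / 2 : ℝ) ^ (Δε - Δσ) *
              |evenKernel (w 2) S ((Δσ + Δε) / 2) (-1) ((E - (j : ℝ)) / 2 + q.1) ((E - (j : ℝ)) / 2 + q.2)|) +
            κ₀⁻¹ / 2 * ((1 / 2 : ℝ) ^ (-(2 * Δε)) *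
              evenKernel ψ Sψ (Δσ - Δε) 0 ((E - (j : ℝ)) / 2 + q.1) ((E - (j : ℝ)) / 2 + q.2)) ≤
          evenKernel (w 3) S Δσ (-1) ((E - (j : ℝ)) / 2 + q.1) ((E - (j : ℝ)) / 2 + q.2) -
            evenKernel (w 4) S Δσ 1 ((E - (j : ℝ)) / 2 + q.1) ((E - (j : ℝ)) / 2 + q.2) := by
    intro q hq
    have hq' : (q.1 : ℝ) + q.2 = j := by exact_mod_cast mem_antidiagonal.mp hq
    have h1 : (0 : ℝ) ≤ (E - (j : ℝ)) / 2 := by linarith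
    exact hK _ _ (add_nonneg h1 (Nat.cast_nonneg _)) (add_nonneg h1 (Nat.cast_nonneg _)) (by linarith)
  -- |q̂₃| against the λ-average of |K₃|
  have habs : |qSum (w 2) S ((Δσ + Δε) / 2) (-1) E j| ≤
      ∑ q ∈ antidiagonal j, legendreLam q.1 * legendreLam q.2 *
        |evenKernel (w 2) S ((Δσ + Δε) / 2) (-1) ((E - (j : ℝ)) / 2 + q.1) ((E - (j : ℝ)) / 2 + q.2)| := by
    rw [qSum_eq_sum_evenKernel]
    exact abs_sum_antidiagonal_lam_le j _
  refine oddConeAt_half_of_qCone S w Sψ ψ κ₀ Δσ Δε E j hj ?_ ?_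
  · -- (M̂)
    calc (1 / 2 : ℝ) ^ (Δσ + Δε) * |qSum (w 2) S ((Δσ + Δε) / 2) (-1) E j|
        ≤ (1 / 2 : ℝ) ^ (Δσ + Δε) * ∑ q ∈ antidiagonal j, legendreLam q.1 * legendreLam q.2 *
            |evenKernel (w 2) S ((Δσ + Δε) / 2) (-1) ((E - (j : ℝ)) / 2 + q.1) ((E - (j : ℝ)) / 2 + q.2)| :=
          mul_le_mul_of_nonneg_left habs hκ₁
      _ = ∑ q ∈ antidiagonal j, legendreLam q.1 * legendreLam q.2 * ((1 / 2 : ℝ) ^ (Δσ + Δε) *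
            |evenKernel (w 2) S ((Δσ + Δε) / 2) (-1) ((E - (j : ℝ)) / 2 + q.1) ((E - (j : ℝ)) / 2 + q.2)|) := by
          rw [Finset.mul_sum]
          exact Finset.sum_congr rfl fun q _ => by ring
      _ ≤ ∑ q ∈ antidiagonal j, legendreLam q.1 * legendreLam q.2 *
            evenKernel ψ Sψ 0 0 ((E - (j : ℝ)) / 2 + q.1) ((E - (j : ℝ)) / 2 + q.2) :=
          Finset.sum_le_sum fun q hq => mul_le_mul_of_nonneg_left (hKq q hq).1 (hlam0 q)
      _ = qSum ψ Sψ 0 0 E j := by rw [qSum_eq_sum_evenKernel]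
  · -- (R̂)
    have h1 : κ₀ / 2 * ((1 / 2 : ℝ) ^ (Δε - Δσ) * |qSum (w 2) S ((Δσ + Δε) / 2) (-1) E j|) ≤
        κ₀ / 2 * ((1 / 2 : ℝ) ^ (Δε - Δσ) * ∑ q ∈ antidiagonal j, legendreLam q.1 * legendreLam q.2 *
          |evenKernel (w 2) S ((Δσ + Δε) / 2) (-1) ((E - (j : ℝ)) / 2 + q.1) ((E - (j : ℝ)) / 2 + q.2)|) :=
      mul_le_mul_of_nonneg_left (mul_le_mul_of_nonneg_left habs hκ₂) (by positivity)
    have h2 : κ₀ / 2 * ((1 / 2 : ℝ) ^ (Δε - Δσ) * ∑ q ∈ antidiagonal j, legendreLam q.1 * legendreLam q.2 *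
            |evenKernel (w 2) S ((Δσ + Δε) / 2) (-1) ((E - (j : ℝ)) / 2 + q.1) ((E - (j : ℝ)) / 2 + q.2)|) +
          κ₀⁻¹ / 2 * ((1 / 2 : ℝ) ^ (-(2 * Δε)) * qSum ψ Sψ (Δσ - Δε) 0 E j) =
        ∑ q ∈ antidiagonal j, legendreLam q.1 * legendreLam q.2 *
          (κ₀ / 2 * ((1 / 2 : ℝ) ^ (Δε - Δσ) *
              |evenKernel (w 2) S ((Δσ + Δε) / 2) (-1) ((E - (j : ℝ)) / 2 + q.1) ((E - (j : ℝ)) / 2 + q.2)|) +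
            κ₀⁻¹ / 2 * ((1 / 2 : ℝ) ^ (-(2 * Δε)) *
              evenKernel ψ Sψ (Δσ - Δε) 0 ((E - (j : ℝ)) / 2 + q.1) ((E - (j : ℝ)) / 2 + q.2))) := by
      rw [qSum_eq_sum_evenKernel]
      simp only [Finset.mul_sum]
      rw [← Finset.sum_add_distrib]
      exact Finset.sum_congr rfl fun q _ => by ring
    have h3 : ∑ q ∈ antidiagonal j, legendreLam q.1 * legendreLam q.2 *
          (κ₀ / 2 * ((1 / 2 : ℝ) ^ (Δε - Δσ) *
              |evenKernel (w 2) S ((Δσ + Δε) / 2) (-1) ((E - (j : ℝ)) / 2 + q.1) ((E - (j : ℝ)) / 2 + q.2)|) +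
            κ₀⁻¹ / 2 * ((1 / 2 : ℝ) ^ (-(2 * Δε)) *
              evenKernel ψ Sψ (Δσ - Δε) 0 ((E - (j : ℝ)) / 2 + q.1) ((E - (j : ℝ)) / 2 + q.2))) ≤
        ∑ q ∈ antidiagonal j, legendreLam q.1 * legendreLam q.2 *
          (evenKernel (w 3) S Δσ (-1) ((E - (j : ℝ)) / 2 + q.1) ((E - (j : ℝ)) / 2 + q.2) -
            evenKernel (w 4) S Δσ 1 ((E - (j : ℝ)) / 2 + q.1) ((E - (j : ℝ)) / 2 + q.2)) :=
      Finset.sum_le_sum fun q hq => mul_le_mul_of_nonneg_left (hKq q hq).2 (hlam0 q)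
    have h4 : ∑ q ∈ antidiagonal j, legendreLam q.1 * legendreLam q.2 *
          (evenKernel (w 3) S Δσ (-1) ((E - (j : ℝ)) / 2 + q.1) ((E - (j : ℝ)) / 2 + q.2) -
            evenKernel (w 4) S Δσ 1 ((E - (j : ℝ)) / 2 + q.1) ((E - (j : ℝ)) / 2 + q.2)) =
        qSum (w 3) S Δσ (-1) E j - qSum (w 4) S Δσ 1 E j := by
      rw [qSum_eq_sum_evenKernel, qSum_eq_sum_evenKernel, ← Finset.sum_sub_distrib]
      exact Finset.sum_congr rfl fun q _ => by ring
    linarith [h1, h2, h3, h4]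

end Summit.CriticalPhenomena.Ising3D
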